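import Summits.HodgeConjecture.HodgeConjecture.Theses.SplitImpliesAll
import Summits.HodgeConjecture.HodgeConjecture.Theorems.Ring2AbelianAllWeilCellsAnchorPointed
import Summits.HodgeConjecture.HodgeConjecture.Theorems.Ring2AbelianAllWeilCellsAnchored
import Summits.HodgeConjecture.HodgeConjecture.Theorems.Ring2AbelianAllWeilCellsInhabited
import Summits.HodgeConjecture.HodgeConjecture.Theorems.Ring2AbelianAllWeilSignature
import Summits.HodgeConjecture.HodgeConjecture.Theorems.Ring2AbelianAllAndreDiscriminantTransport
import Literature.AlgebraicGeometry.HodgeTheory.WeilFamilyPeriodConstructionAtWeilType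
import Literature.AlgebraicGeometry.HodgeTheory.WeilFamilyReachSimilarOfConstruction
import Literature.AlgebraicGeometry.HodgeTheory.WeilFamilyReachSimilarOfMonodromy
import Literature.AlgebraicGeometry.HodgeTheory.WeilTypeClassReachOfPeriodSurjective
import Literature.AlgebraicGeometry.HodgeTheory.AbelianVarietyHodgeHomFullnessHolds
import Literature.AlgebraicGeometry.HodgeTheory.MotivatedClassesDeformationInputs
import Literature.AlgebraicGeometry.HodgeTheory.DirectImageEndomorphism
import Literature.AlgebraicGeometry.HodgeTheory.WeilFamilyGlobalAction
import Literature.AlgebraicGeometry.HodgeTheory.IsoTransport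
import Literature.AlgebraicGeometry.HodgeTheory.FlatSectionNonvanishing
import Literature.AlgebraicGeometry.HodgeTheory.HyperplaneSectionFamilyGoodFibres
import Literature.AlgebraicGeometry.HodgeTheory.QbarFamilyLocalSystem
import Literature.AlgebraicGeometry.HodgeTheory.InvariantClassesFromTotalSpace
import Literature.AlgebraicGeometry.HodgeTheory.InvariantClassesFromTotalSpaceHolds
import Literature.AlgebraicGeometry.HodgeTheory.HodgeGenericQbarDescentFiniteMonodromyProofs
import Literature.AlgebraicGeometry.HodgeTheory.WeilTypePeriodPoint
import Literature.AlgebraicGeometry.HodgeTheory.AbelianVarietyPullbackQuadratic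
import Literature.AlgebraicGeometry.HodgeTheory.AbelianVarietyMultiplicationPullback
import Literature.AlgebraicGeometry.HodgeTheory.WeilClassesHodgeType
import Literature.AlgebraicGeometry.HodgeTheory.WeilTypeAbelianVariety
import Literature.AlgebraicGeometry.HodgeTheory.KaehlerClass
import Literature.AlgebraicGeometry.HodgeTheory.WeilFamilyBalanced
import Literature.AlgebraicGeometry.Motives.HyperbolicWeilTypeProduct
import Literature.AlgebraicGeometry.Motives.SegreHyperplaneClass
import Literature.NumberTheory.EllipticCurves.CMEndomorphismOfMulMemLattice
import HarnessLib

/-!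
# `SplitImpliesAll.NonsplitCellsConnected` ⟸ Deligne's period construction at Weil type (J1), BY NAME

SUPPORT file for item stmt-HodgeConjecture-19825 (`NonsplitCellsConnected`, crux rank 4 of route `SplitImpliesAll`, labelled
IN PRINT): ring 2's anchor-pointed leaf `Ring2.AbelianAll.IsogenyConnectedToCMAnchor n d δ` (N73) holds on EVERY cell `(n, d, δ)`,
`n, d ≥ 1`, modulo the ONE named Literature fact `deligne1982_weilFamily_periodConstructionAtWeilType` («J1»: Deligne 1982 §4,
proof of Thm. 4.8, with van Geemen 1994, 5.3–5.5; UNPROVED named fact) and nothing else — the second input, Deligne's 1968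
degeneration theorem «L» `deligne1968_invariantClass_fromTotalSpace`, is a TREE THEOREM (`…_holds`). Chain (the vhodge cell's
refereed memo companion ROUTE-P3-g10-Sketch §7.0/§7.2/§7.4, extracted minimal): `CellFibre`/`CellSystemReachAt` (the cell as a
fibre relation + its family-first reach package) → `cellSystemReachAt_of_J1` (package DERIVED from the level-`(n,d)` slice of J1)
→ `isogenyConnectedToCMAnchor_of_cellSystemReachAt` (N73 from the package + L) → `nonsplitCellsConnected_of_J1 : J1 → K3` and
`weilSixfolds_of_J1_of_split_of_nonsplitVariational : J1 → K2 → K1 → WeilSixfolds` (the route's exact reach modulo J1, via `closes`).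
HONEST STATUS: J1 is a hypothesis, never asserted; the item stays OPEN; no case of the Hodge conjecture is proved here.
-/

noncomputable section
set_option linter.dupNamespace false

open CategoryTheory AlgebraicGeometry Limits MonoidalCategory CartesianMonoidalCategory
open Literature.AlgebraicGeometry Literature.AlgebraicGeometry.Motives
open Literature.AlgebraicGeometry.HodgeTheory
open Literature.AlgebraicGeometry.VanGeemen1994
open Literature.AlgebraicTopology.SingularHomology
open Summit.HodgeConjecture.HodgeConjecture.Ring2.Hypotheses
open Summit.HodgeConjecture.HodgeConjecture.Ring2.AbelianAll

namespace Summit.HodgeConjecture.HodgeConjecture.Theorems.SplitImpliesAllNonsplitCellsConnectedOfJ1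

/-! ## §0 Notation -/
/-- `h_K(e, a) = d·e^*a + Ψ^*e^*a`, the `K`-symmetrised hyperplane class. [cite: vanGeemen1994HodgeAV, 4.9 and Lemma 5.2 (1)–(2)] -/
abbrev kSymmClass (A : AbelianVariety ℂ) (Ψ : A ⟶ A) (d : ℕ) (e : ProjectiveEmbedding A.X)
    (a : complexBetti (projectiveSpace e.n ℂ) 2) : complexBetti A.X 2 :=
  (d : ℂ) • complexBetti.map e.ι 2 a + complexBetti.map Ψ.hom.hom.hom 2 (complexBetti.map e.ι 2 a)

/-- A fibrewise property of `√-d`-pairs that a reach package may certify and a germ clause may assume. -/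
abbrev FibreRel : Type _ := ∀ Y : AbelianVariety ℂ, (Y ⟶ Y) → Prop

variable {n d : ℕ}

/-- **`ψ₀^* h_K = d · h_K`** for `ψ₀² = −d` and `h_K = d·h + ψ₀^*h`: `ψ₀^*(d·h + ψ₀^*h) = d·ψ₀^*h + (ψ₀²)^*h = d·ψ₀^*h + d²·h`
(`(-f)^* = f^*` and `[m]^* = m²` on `H²`). [cite: Lange2023AbelianVarietiesComplex, Lemma 1.1.17 and Prop. 1.1.15] (Mumford, Abelian Varieties §19 — not held) -/
theorem map_kSymmClass_eq_smul {P : AbelianVariety ℂ} {ψ₀ : P ⟶ P} {d : ℕ} (hψ : ψ₀ ≫ ψ₀ = -(d • 𝟙 P))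
    (e : ProjectiveEmbedding P.X) (a : complexBetti (projectiveSpace e.n ℂ) 2) :
    complexBetti.map ψ₀.hom.hom.hom 2 (kSymmClass P ψ₀ d e a) = (d : ℂ) • kSymmClass P ψ₀ d e a := by
  have h2 : complexBetti.map ψ₀.hom.hom.hom 2 (complexBetti.map ψ₀.hom.hom.hom 2 (complexBetti.map e.ι 2 a)) =
      ((d : ℂ) ^ 2) • complexBetti.map e.ι 2 a := by
    have hc : complexBetti.map ψ₀.hom.hom.hom 2 (complexBetti.map ψ₀.hom.hom.hom 2 (complexBetti.map e.ι 2 a)) =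
        complexBetti.map (ψ₀ ≫ ψ₀).hom.hom.hom 2 (complexBetti.map e.ι 2 a) := by
      change _ = complexBetti.map (ψ₀.hom.hom.hom ≫ ψ₀.hom.hom.hom) 2 _
      rw [complexBetti.map_comp, ModuleCat.comp_apply]
    rw [hc, hψ, map_neg_two, complexBetti_map_nsmul_id_apply]
  dsimp only [kSymmClass]
  rw [map_add, map_smul, h2, smul_add, smul_smul, ← sq, add_comm]

/-- **`h_K ≠ 0`**: `h_K` is a non-zero real multiple of a Kähler class (`exists_isKaehlerClass_ksymm_eq_smul`) and Kähler classes of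
positive-dimensional smooth projective varieties are non-zero (`IsKaehlerClass.ne_zero`). [cite: VoisinHodgeI2002, §3.1.3 Cor. 3.9 and §7.1.2] -/
theorem kSymmClass_ne_zero {P : AbelianVariety ℂ} {n d : ℕ} (hn : 0 < n) (hP : P.dim = 2 * n) (hd : 0 < d) (ψ₀ : P ⟶ P)
    (e : ProjectiveEmbedding P.X) {a : complexBetti (projectiveSpace e.n ℂ) 2} (ha : IsRationalClass a) (ha0 : a ≠ 0) :
    kSymmClass P ψ₀ d e a ≠ 0 := by
  have hP' : P.dim = (2 * n - 1) + 1 := by omega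
  obtain ⟨s, H', hs0, hK, hEq⟩ := exists_isKaehlerClass_ksymm_eq_smul hP' hd ψ₀ e ha ha0
  have hX : IsSmoothProjective ((2 * n - 1) + 1) P.X := Motives.isSmoothProjective_of_dim_eq' hP'
  dsimp only [kSymmClass]
  rw [hEq]
  exact smul_ne_zero (Complex.ofReal_ne_zero.2 hs0) (hK.ne_zero hX (by omega))

/-! ## §1 The cell as fibre relation; the per-cell reach package (memo §7.0) -/
/-- **`CellFibre n d δ` — THE CELL AS A FIBRE RELATION**: `(Y, Ψ)` is polarized, by SOME `K`-symmetrised hyperplane class `h_K(e,a)`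
(`a ≠ 0` rational), with non-degenerate discriminant invariant `det H = δ ∈ ℚˣ/N(K_dˣ)` — the binder shape of ring 2's habitat statement
`WeilClassesComponent n d δ` (part XXVII). (At `δ = [(-1)ⁿ]` and for fibres of Weil type this is
hyperbolicity, by Landherr's converse `isHyperbolicWeilType_iff_hasWeilDiscriminantNondeg_split`.) [cite: vanGeemen1994HodgeAV, Lemma 5.2 (2)–(3), 4.14 and (5.4.1)] -/
def CellFibre (n d : ℕ) (δ : weilNormResidueGroup d) : FibreRel := fun Y Ψ =>
  ∃ (e : ProjectiveEmbedding Y.X) (a : complexBetti (projectiveSpace e.n ℂ) 2), IsRationalClass a ∧ a ≠ 0 ∧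
    HasWeilDiscriminantNondeg Y Ψ n d (kSymmClass Y Ψ d e a) δ

/-- **Fᶜ `CellSystemReachAt n d δ R` — THE FAMILY-FIRST REACH PACKAGE OF THE CELL `(n, d, δ)`.** For every `√-d`-abelian `2n`-fold
`(P, ψ₀)` carrying a non-zero `(n,n)` Weil class (⟺ of Weil type `(n,n)`, Deligne Prop. 4.4) and polarized IN THE CELL by `h_K(e,a)`
(`det H = δ`): a smooth projective family of `√-d`-abelian `2n`-folds over an irreducible smooth quasi-projective base through `P`
(`e' : P ≅ 𝒳_{s₀}`), with abelian fibre charts `(Y_s, Ψ_s, ε_s)` satisfying `R`, a continuous `(n,n)` Weil-valued section through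
every Weil class of `P`, and reaching — up to a `K`-linear isogeny — EVERY member of the cell carrying a non-zero `(n,n)` Weil class
(derived for `R = CellFibre n d δ` in §2). [cite: Deligne1982HodgeCycles, §4 Prop. 4.1, Prop. 4.4 and proof of Thm. 4.8 (re-ed. pp. 34–37)]
[cite: vanGeemen1994HodgeAV, Lemma 5.2, 5.3–5.5 with (5.4.1) and 5.8–5.11] [cite: Landherr1936HermitianForms, Satz] -/
def CellSystemReachAt (n d : ℕ) (δ : weilNormResidueGroup d) (R : FibreRel) : Prop :=
  ∀ (P : AbelianVariety ℂ) (ψ₀ : P ⟶ P) (e : ProjectiveEmbedding P.X) (a : complexBetti (projectiveSpace e.n ℂ) 2),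
    P.dim = 2 * n → ψ₀ ≫ ψ₀ = -(d • 𝟙 P) → IsRationalClass a → a ≠ 0 →
    (∃ c ∈ weilClassesOf P ψ₀ n d, c ≠ 0 ∧ IsOfHodgeType (2 * n) P.X (2 * n) n n c) →
    HasWeilDiscriminantNondeg P ψ₀ n d (kSymmClass P ψ₀ d e a) δ →
    ∃ (𝒳 S : SchemeOver ℂ) (f : 𝒳 ⟶ S) (s₀ : ComplexPoints S) (e' : P.X ≅ fiberOver f s₀)
      (Y : ComplexPoints S → AbelianVariety ℂ) (Ψ : ∀ s, Y s ⟶ Y s) (ε : ∀ s, (Y s).X ≅ fiberOver f s),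
      IsSmoothProjectiveFamily f (2 * n) ∧
      (∃ (N : ℕ) (ι : 𝒳 ⟶ MonoidalCategoryStruct.tensorObj (projectiveSpace N ℂ) S),
        AlgebraicGeometry.IsClosedImmersion ι.left ∧ ι ≫ CartesianMonoidalCategory.snd (projectiveSpace N ℂ) S = f) ∧
      IrreducibleSpace S.left ∧ AlgebraicGeometry.Smooth S.hom ∧ IsQuasiProjectiveOver S ∧
      (∀ s, (Y s).dim = 2 * n ∧ Ψ s ≫ Ψ s = -((d : ℤ) • 𝟙 (Y s))) ∧ (∀ s, R (Y s) (Ψ s)) ∧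
      (∀ w : complexBetti P.X (2 * n), w ∈ weilClassesOf P ψ₀ n d →
        ∃ σ : ComplexPoints S → FiberClass f (2 * n),
          Continuous σ ∧ σ s₀ = ⟨s₀, complexBetti.map e'.inv (2 * n) w⟩ ∧
          ∀ s, ∃ x : complexBetti (fiberOver f s) (2 * n), σ s = ⟨s, x⟩ ∧
            IsOfHodgeType (2 * n) (fiberOver f s) (2 * n) n n x ∧
            complexBetti.map (ε s).hom (2 * n) x ∈ weilClassesOf (Y s) (Ψ s) n d) ∧
      (∀ (A : AbelianVariety ℂ) (φ : A ⟶ A) (eA : ProjectiveEmbedding A.X)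
        (aA : complexBetti (projectiveSpace eA.n ℂ) 2),
        A.dim = 2 * n → φ ≫ φ = -(d • 𝟙 A) → IsRationalClass aA → aA ≠ 0 →
        (∃ c ∈ weilClassesOf A φ n d, c ≠ 0 ∧ IsOfHodgeType (2 * n) A.X (2 * n) n n c) →
        HasWeilDiscriminantNondeg A φ n d (kSymmClass A φ d eA aA) δ →
        ∃ (s : ComplexPoints S) (u : Y s ⟶ A), AbelianVariety.IsIsogeny u ∧ u ≫ φ = Ψ s ≫ u)

/-! ## §2 H1ᶜ — the cell's reach package DERIVED from the level-`(n,d)` slice of J1 (memo §7.2) -/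
/-- **H1ᶜ — THE CELL'S REACH PACKAGE IS DERIVED** (`n, d ≥ 1`, every `δ`): `J1 ⟹ CellSystemReachAt n d δ (CellFibre n d δ)` from the
level-`(n, d)` slice of J1 (the anchor is of Weil type, `isWeilType_of_weilClass_ne_zero`): balanced charts, special-unitary monodromy
(`unitaryMonodromy_of_levelStructureAt`), flat `(n,n)` Weil-valued sections (`flatWeilSections_of_unitaryMonodromyAt`); reach of EVERY member of
the cell by the tree's [U] + Landherr + period-transport + Riemann theorem `exists_isIsogeny_comm_of_periodSurjective_of_hasWeilDiscriminantNondeg`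
fed `hodgeIso_bettiOne_isogeny`; EVERY FIBRE LIES IN THE CELL: the global class `K = (ι ≫ pr₁)^*a'` restricts on `P` to `h_K(e,a)` and on `Y_s`
to `½·h_K(ε_s ≫ ι_s ≫ ι ≫ pr₁, a')` (eigen-equation `g_s^*K_s = d·K_s`, flat from `s₀`), and ring 2's transport of `det H` along a path
(`hasWeilDiscriminantNondeg_of_transportFun` over Ehresmann `isHomotopicallyLocallyTrivialOn_univ`) carries the anchor's witness of class `δ`
to every fibre (`HasWeilDiscriminantNondeg.ratCast_smul` for the factor `2d`). [cite: Deligne1982HodgeCycles, §4 Prop. 4.1, Prop. 4.4 and proof of Thm. 4.8 (re-ed. pp. 34–37)]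
[cite: vanGeemen1994HodgeAV, Lemma 5.2 (2)–(3), 4.14, 5.3–5.5 and 5.8–5.11] [cite: VoisinHodgeI2002, Thm. 9.3 and §9.2.1] [cite: VoisinHodgeII2003, §3.1.2]
[cite: Landherr1936HermitianForms, Satz] [cite: Lange2023AbelianVarietiesComplex, Prop. 1.1.6 (b), eq. (1.2), Lemma 1.1.11, Lemma 1.1.17, Thm. 2.1.13, Cor. 2.1.17 and Cor. 2.4.11] -/
theorem cellSystemReachAt_of_J1 (hJ : deligne1982_weilFamily_periodConstructionAtWeilType) (hn : 1 ≤ n) (hd : 1 ≤ d)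
    (δ : weilNormResidueGroup d) : CellSystemReachAt n d δ (CellFibre n d δ) := by
  have h := hJ n d hn hd
  intro P ψ₀ e a hP hψ ha ha0 hweilP hδP
  have hn0 : 0 < n := hn
  have hd0 : 0 < d := hd
  have hψℤ : ψ₀ ≫ ψ₀ = -((d : ℤ) • 𝟙 P) := by rw [natCast_zsmul]; exact hψ
  -- the anchor is of Weil type (Prop. 4.4 ⇐ from its non-zero `(n,n)` Weil class)
  obtain ⟨c, hcW, hc0, hcH⟩ := hweilP
  have hWP : IsWeilType P ψ₀ n d := isWeilType_of_weilClass_ne_zero hn0 hd0 hP hψ hcW hc0 hcH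
  -- Deligne's period construction at `(P, ψ₀, h_K(e,a))`
  obtain ⟨𝒳, S, f, g, s₀, e', Y, Ψ, ε, N, ι, a', hfam, hιci, hιf, hirr, hsm, hqp, hg, he', hfib, hlev, hPer, ha', hH₀⟩ :=
    h P ψ₀ e a hP hψℤ ha ha0 hWP
  -- balanced charts (3), special-unitary monodromy (4), flat `(n,n)` Weil-valued sections (c): the tree's chain, verbatim
  have hbalP := finrank_eq_of_mem_weilClassesOf hn0 hP hd0 hψ hcW hc0 hcH
  have hbal := balancedCharts_of_constructionAt hn0 hd0 hP hψ hbalP f g e' Y Ψ ε hfam ⟨N, ι, hιci, hιf⟩ hirr hsm hqp hg he' hfib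
  have hdet := unitaryMonodromy_of_levelStructureAt hd0 hψ f g e' hg he' hlev
  have hsec := flatWeilSections_of_unitaryMonodromyAt hn0 hd0 hP hψ f g e' Y Ψ ε hfam hirr hsm hqp hg he'
    (fun s ↦ ⟨(hfib s).1, (hfib s).2.1, (hfib s).2.2, hbal s⟩) hdet
  -- reach INSIDE THE CELL: [U] + Landherr + period transport + Riemann's theorem [F]
  have hreach : ∀ (A : AbelianVariety ℂ) (φ : A ⟶ A) (eA : ProjectiveEmbedding A.X) (aA : complexBetti (projectiveSpace eA.n ℂ) 2),
      A.dim = 2 * n → φ ≫ φ = -(d • 𝟙 A) → IsRationalClass aA → aA ≠ 0 →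
      (∃ c ∈ weilClassesOf A φ n d, c ≠ 0 ∧ IsOfHodgeType (2 * n) A.X (2 * n) n n c) →
      HasWeilDiscriminantNondeg A φ n d (kSymmClass A φ d eA aA) δ →
      ∃ (s : ComplexPoints S) (u : Y s ⟶ A), AbelianVariety.IsIsogeny u ∧ u ≫ φ = Ψ s ≫ u :=
    fun A φ eA aA hA hφ haA haA0 hweilA hδA =>
      exists_isIsogeny_comm_of_periodSurjective_of_hasWeilDiscriminantNondeg hn hP e ha ha0 ⟨c, hcW, hc0, hcH⟩ hδP Y Ψ
        (fun s ↦ (hfib s).1) hPer hodgeIso_bettiOne_isogeny hA hφ eA haA haA0 hweilA hδA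
  -- EVERY FIBRE LIES IN THE CELL. The base: `S(ℂ)` is a compact-base, path-connected manifold; `f(ℂ)` is homotopically locally trivial (Ehresmann)
  haveI := hsm
  haveI := hirr
  haveI : LocallyOfFiniteType S.hom := hqp.locallyOfFiniteType
  haveI : IsSeparated S.hom := hqp.isVarietyPair_ofScheme.isSeparated
  haveI : QuasiCompact S.hom := hqp.isVarietyPair_ofScheme.quasiCompact
  haveI : CompactSpace S.left := QuasiCompact.compactSpace_of_compactSpace S.hom
  haveI := hfam.smoothOfRelativeDimension
  haveI := hfam.isProper
  haveI : ConnectedSpace (ComplexPoints S) := (Motives.ComplexPoints.connectedSpace_iff_holds S).2 inferInstance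
  obtain ⟨dS, hdS⟩ := exists_smoothOfRelativeDimension_of_connectedSpace_complexPoints S
  haveI := hdS
  haveI := pathConnectedSpace_complexPoints_of_smoothOfRelativeDimension S dS
  have hHlt : IsHomotopicallyLocallyTrivialOn f (Set.univ : Set (ComplexPoints S)) :=
    isHomotopicallyLocallyTrivialOn_univ f (2 * n) dS
  have hUc : IsCohomologicallyLocallyTrivialOn f (Set.univ : Set (ComplexPoints S)) := hHlt.isCohomologicallyLocallyTrivialOn
  -- the fibre maps of `g`
  have hgf' := fun t ↦ exists_fiberHom_comp_fiberι f g hg t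
  choose gf hgf using hgf'
  have he₀ : e'.hom ≫ gf s₀ = ψ₀.hom.hom.hom ≫ e'.hom :=
    hom_comp_fiberHom_eq_of_comp_fiberι f g (hgf s₀) e' ψ₀.hom.hom.hom he'
  -- the global relative hyperplane-type class `K = (ι ≫ pr₁)^* a'` and its restrictions `K_s = (ι_s ≫ ι ≫ pr₁)^* a'`
  obtain ⟨K, hKdef⟩ : ∃ K : complexBetti 𝒳 2,
      K = complexBetti.map (ι ≫ CartesianMonoidalCategory.fst (projectiveSpace N ℂ) S) 2 a' := ⟨_, rfl⟩
  rw [← hKdef] at hH₀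
  have hKs : ∀ s, complexBetti.map (fiberι f s) 2 K =
      complexBetti.map (fiberι f s ≫ ι ≫ CartesianMonoidalCategory.fst (projectiveSpace N ℂ) S) 2 a' := fun s => by
    rw [hKdef, complexBetti.map_comp (fiberι f s), ModuleCat.comp_apply]
  -- `h_K ≠ 0`, hence `a' ≠ 0`
  have hK0 : kSymmClass P ψ₀ d e a ≠ 0 := kSymmClass_ne_zero hn0 hP hd0 ψ₀ e ha ha0
  have ha'0 : a' ≠ 0 := by
    intro h0
    apply hK0
    have hK' : kSymmClass P ψ₀ d e a = complexBetti.map e'.hom 2 (complexBetti.map (fiberι f s₀) 2 K) := hH₀.symm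
    rw [hK', hKdef, h0, map_zero, map_zero, map_zero]
  -- the eigen-equation at `s₀`: `g_{s₀}^* K_{s₀} = d · K_{s₀}` (read on `P` through `e'`: `ψ₀^* h_K = d · h_K`)
  have hEP : complexBetti.map ψ₀.hom.hom.hom 2 (kSymmClass P ψ₀ d e a) = (d : ℂ) • kSymmClass P ψ₀ d e a :=
    map_kSymmClass_eq_smul hψ e a
  have hE₀ : complexBetti.map (gf s₀) 2 (complexBetti.map (fiberι f s₀) 2 K) = (d : ℂ) • complexBetti.map (fiberι f s₀) 2 K := by
    apply (complexBetti.bijective_map_of_iso e' 2).1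
    have h1 : complexBetti.map e'.hom 2 (complexBetti.map (gf s₀) 2 (complexBetti.map (fiberι f s₀) 2 K)) =
        complexBetti.map ψ₀.hom.hom.hom 2 (complexBetti.map e'.hom 2 (complexBetti.map (fiberι f s₀) 2 K)) := by
      rw [← ModuleCat.comp_apply (complexBetti.map (gf s₀) 2) (complexBetti.map e'.hom 2), ← complexBetti.map_comp, he₀,
        complexBetti.map_comp, ModuleCat.comp_apply]
    change complexBetti.map e'.hom 2 (complexBetti.map (gf s₀) 2 (complexBetti.map (fiberι f s₀) 2 K)) =
      complexBetti.map e'.hom 2 ((d : ℂ) • complexBetti.map (fiberι f s₀) 2 K)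
    rw [h1, map_smul, hH₀, hEP]
  -- the eigen-equation at every `s`: the global class `g^*K − d·K` restricts to `g_s^*K_s − d·K_s`, is flat, and vanishes at `s₀`
  have hE : ∀ s, complexBetti.map (gf s) 2 (complexBetti.map (fiberι f s) 2 K) = (d : ℂ) • complexBetti.map (fiberι f s) 2 K := by
    intro s
    have hG : ∀ t, complexBetti.map (fiberι f t) 2 (complexBetti.map g 2 K - (d : ℂ) • K) =
        complexBetti.map (gf t) 2 (complexBetti.map (fiberι f t) 2 K) - (d : ℂ) • complexBetti.map (fiberι f t) 2 K := by
      intro t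
      rw [map_sub, map_smul, ← ModuleCat.comp_apply (complexBetti.map g 2) (complexBetti.map (fiberι f t) 2),
        ← complexBetti.map_comp, ← hgf t, complexBetti.map_comp, ModuleCat.comp_apply]
    obtain ⟨γ⟩ : Nonempty (Path.Homotopic.Quotient (⟨s₀, Set.mem_univ s₀⟩ : (Set.univ : Set (ComplexPoints S))) ⟨s, Set.mem_univ s⟩) :=
      ⟨⟦(PathConnectedSpace.somePath s₀ s).map (continuous_id.subtype_mk _)⟧⟩
    have htr : transportFun f 2 hUc γ (complexBetti.map (fiberι f s₀) 2 (complexBetti.map g 2 K - (d : ℂ) • K)) =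
        complexBetti.map (fiberι f s) 2 (complexBetti.map g 2 K - (d : ℂ) • K) :=
      transportFun_map_fiberι f 2 hUc γ _
    rw [hG, hG, hE₀, sub_self, transportFun_zero] at htr
    exact sub_eq_zero.1 htr.symm
  -- the anchor's non-degenerate witness of class `δ`, read on the chart `e'` for the global class `K`
  have hδ₀ : HasWeilDiscriminantNondeg P ψ₀ n d (complexBetti.map e'.hom 2 (complexBetti.map (fiberι f s₀) 2 K)) δ := by
    rw [hH₀]; exact hδP
  -- fibrewise cell membership, read on the chart `(Y_s, Ψ_s, ε_s)` with the embedding `ε_s ≫ ι_s ≫ ι ≫ pr₁` and the class `a'`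
  have hCell : ∀ s, CellFibre n d δ (Y s) (Ψ s) := by
    intro s
    obtain ⟨-, -, hεg⟩ := hfib s
    have hεs : (ε s).hom ≫ gf s = (Ψ s).hom.hom.hom ≫ (ε s).hom :=
      hom_comp_fiberHom_eq_of_comp_fiberι f g (hgf s) (ε s) (Ψ s).hom.hom.hom hεg
    obtain ⟨γ⟩ : Nonempty (Path.Homotopic.Quotient (⟨s₀, Set.mem_univ s₀⟩ : (Set.univ : Set (ComplexPoints S))) ⟨s, Set.mem_univ s⟩) :=
      ⟨⟦(PathConnectedSpace.somePath s₀ s).map (continuous_id.subtype_mk _)⟧⟩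
    -- transport of `det H` along `γ` (elaborated WITHOUT expected type: the conclusion mentions `t.1`)
    have hT := hasWeilDiscriminantNondeg_of_transportFun f hHlt g hg gf hgf K γ e' (ε s) he₀ hεs hδ₀
    haveI := hιci
    haveI : IsIso (ε s).hom.left := (inferInstance : IsIso ((Over.forget _).mapIso (ε s)).hom)
    haveI := SectionFamily.isClosedImmersion_fiberι_comp_fst_left f ι hιf s
    have hcl : AlgebraicGeometry.IsClosedImmersion
        ((ε s).hom ≫ fiberι f s ≫ ι ≫ CartesianMonoidalCategory.fst (projectiveSpace N ℂ) S).left := by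
      rw [Over.comp_left]
      infer_instance
    have hι' : complexBetti.map ((ε s).hom ≫ fiberι f s ≫ ι ≫ CartesianMonoidalCategory.fst (projectiveSpace N ℂ) S) 2 a' =
        complexBetti.map (ε s).hom 2 (complexBetti.map (fiberι f s) 2 K) := by
      rw [hKs s, ← ModuleCat.comp_apply (complexBetti.map (fiberι f s ≫ ι ≫ CartesianMonoidalCategory.fst (projectiveSpace N ℂ) S) 2)
        (complexBetti.map (ε s).hom 2), ← complexBetti.map_comp]
    have hΨK : complexBetti.map (Ψ s).hom.hom.hom 2 (complexBetti.map (ε s).hom 2 (complexBetti.map (fiberι f s) 2 K)) =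
        (d : ℂ) • complexBetti.map (ε s).hom 2 (complexBetti.map (fiberι f s) 2 K) := by
      rw [← ModuleCat.comp_apply (complexBetti.map (ε s).hom 2) (complexBetti.map (Ψ s).hom.hom.hom 2), ← complexBetti.map_comp,
        ← hεs, complexBetti.map_comp, ModuleCat.comp_apply, hE s, map_smul]
    refine ⟨⟨N, _, hcl⟩, a', ha', ha'0, ?_⟩
    show HasWeilDiscriminantNondeg (Y s) (Ψ s) n d
      ((d : ℂ) • complexBetti.map ((ε s).hom ≫ fiberι f s ≫ ι ≫ CartesianMonoidalCategory.fst (projectiveSpace N ℂ) S) 2 a' +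
        complexBetti.map (Ψ s).hom.hom.hom 2
          (complexBetti.map ((ε s).hom ≫ fiberι f s ≫ ι ≫ CartesianMonoidalCategory.fst (projectiveSpace N ℂ) S) 2 a')) δ
    rw [hι', hΨK, ← add_smul, ← two_mul]
    have h2 := hT.ratCast_smul (c := 2 * d) (mul_ne_zero two_ne_zero (Nat.cast_ne_zero.2 hd0.ne'))
    push_cast at h2
    exact h2
  exact ⟨𝒳, S, f, s₀, e', Y, Ψ, ε, hfam, ⟨N, ι, hιci, hιf⟩, hirr, hsm, hqp, fun s ↦ ⟨(hfib s).1, (hfib s).2.1⟩, hCell, hsec, hreach⟩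

/-! ## §3 M1ᶜ — ring 2's anchor-pointed leaf N73 per cell, from the package and L (memo §7.4) -/
/-- **M1ᶜ — N73 FROM THE CELL'S REACH PACKAGE AND L** (`n, d ≥ 1`, every `δ`; no `HC_CM`, no Hodge conjecture). Given a target `(A, φ, h_K(e_A,a_A))`
of exact class `δ` with a non-zero rational `(n,n)` Weil class `c`: run the package AT THE TARGET, so that `e' : A ≅ 𝒳_{s₀}` is a fibre chart; the
flat section `σ` through `c` is at `s₀` the restriction of a global class `W ∈ H^{2n}(𝒳)` (L; `𝒳` is quasi-projective as a closed subscheme of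
`ℙᴺ × S`), hence everywhere (uniqueness of flat continuation over the connected base: the espace étalé of `R^{2n}f_*ℂ` is a covering,
`isCoveringMap_fiberClassPt`, and Mathlib's `IsCoveringMap.eq_of_comp_eq`); so `W` is fibrewise of type `(n,n)` in the Weil planes (section datum),
fibrewise rational (flat transport of the rational class `e'⁻¹*c`, `isRationalClass_transportFun_of_isSmoothProjectiveFamily`), reads `c` at `s₀`, and
every fibre is `δ`-charted (fibre relation `CellFibre`). The far end is the CM TOWER: `A` is of Weil type (Prop. 4.4 ⇐), so the cell is realisable
(LI-a) and ring 2's CM member of exact class `δ` (`exists_cmMember`) is a target of the package — some fibre `Y_{s₁}` is `K`-isogenous to it, which is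
`cmTowerAnchor n d 𝒳_{s₁} _` verbatim. [cite: Deligne1968, Prop. (2.1) with (2.6.3)] [cite: VoisinHodgeII2003, Thm. 4.18 and Lemma 4.17]
[cite: vanGeemen1994HodgeAV, 4.11, 4.14, Lemma 5.2 (3) and 5.3] [cite: Deligne1982HodgeCycles, §4, proof of Thm. 4.8 (a)–(c)] -/
theorem isogenyConnectedToCMAnchor_of_cellSystemReachAt (hn : 1 ≤ n) (hd : 1 ≤ d) {δ : weilNormResidueGroup d}
    (hF : CellSystemReachAt n d δ (CellFibre n d δ)) (hL : deligne1968_invariantClass_fromTotalSpace) :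
    IsogenyConnectedToCMAnchor n d δ := by
  intro A φ hA _ hφ eA aA haA haA0 hδA c hcQ hcH hcW hc0
  have hn0 : 0 < n := hn
  have hd0 : 0 < d := hd
  have hWA : IsWeilType A φ n d := isWeilType_of_weilClass_ne_zero hn0 hd0 hA hφ hcW hc0 hcH
  have hsign : weilSign d δ = (-1) ^ n := weilSign_eq_of_hasWeilDiscriminantNondeg hWA eA haA haA0 hδA
  -- the package AT THE TARGET
  obtain ⟨𝒳, S, f, s₀, e', Y, Ψ, ε, hfam, hemb, hirr, hsm, hSqp, hYΨ, hRfib, hsec, hreach⟩ :=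
    hF A φ eA aA hA hφ haA haA0 ⟨c, hcW, hc0, hcH⟩ hδA
  -- the CM tower member of the cell (ring 2, part 4) and the reach to it
  obtain ⟨g, hgr, hgnz, hgσ⟩ := exists_segreHyperplaneClasses
  obtain ⟨E₀, χ₀, hE, hχ⟩ := Literature.NumberTheory.EllipticCurves.CMEndomorphism.exists_cmCurve_sqrt_neg d hd0
  obtain ⟨B, φB, eB, hWB, hen, hNB, -, hgen, hcm⟩ := exists_cmMember g hgr hgnz hgσ hE hd0 hχ hn0 hsign
  obtain ⟨wB, hwBW, -, hwBH, hwB0⟩ := exists_weilClass_of_isWeilType hWB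
  obtain ⟨s₁, u, hu, -⟩ :=
    hreach B φB eB (g eB.n) hWB.dim_eq hWB.sq_eq (hgr _) (hgnz _ hen) ⟨wB, hwBW, hwB0, hwBH⟩ hNB
  -- base topology: `S(ℂ)` is a connected manifold and `R^{2n} f_* ℂ` is a local system on it
  haveI := hsm
  haveI := hirr
  haveI : LocallyOfFiniteType S.hom := hSqp.locallyOfFiniteType
  haveI : ConnectedSpace (ComplexPoints S) := (Motives.ComplexPoints.connectedSpace_iff_holds S).2 inferInstance
  obtain ⟨dS, hdS⟩ := exists_smoothOfRelativeDimension_of_connectedSpace_complexPoints S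
  haveI := hdS
  haveI := pathConnectedSpace_complexPoints_of_smoothOfRelativeDimension S dS
  have hUc : IsCohomologicallyLocallyTrivialOn f (Set.univ : Set (ComplexPoints S)) :=
    isCohomologicallyLocallyTrivialOn_univ_of_isSmoothProjectiveFamily f dS hfam hSqp
  -- the total space is quasi-projective (closed in `ℙᴺ × S`)
  obtain ⟨N, ι, hιci, -⟩ := hemb
  haveI := hιci
  have h𝒳 : IsQuasiProjectiveOver 𝒳 := IsQuasiProjectiveOver.of_isClosedImmersion_projectiveSpace_tensor ι hSqp
  -- the flat section through `c` IS the restriction of a global class `W`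
  obtain ⟨σ, hσc, hσ₀, hval⟩ := hsec c hcW
  have hpt : ∀ s, (σ s).pt = s := fun s => by
    obtain ⟨x, hx, -⟩ := hval s
    rw [hx]
  obtain ⟨W, hW₀⟩ := hL 𝒳 S f (2 * n) hfam h𝒳 hSqp hsm (2 * n) σ hσc hpt s₀
  have hσW : σ = globalSection f (2 * n) W :=
    (isCoveringMap_fiberClassPt f (2 * n) hUc).eq_of_comp_eq hσc (continuous_globalSection f (2 * n) W)
      (funext fun s => by
        show (σ s).pt = (globalSection f (2 * n) W s).pt
        rw [hpt s]
        rfl) s₀ hW₀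
  have hWval : ∀ s, IsOfHodgeType (2 * n) (fiberOver f s) (2 * n) n n (complexBetti.map (fiberι f s) (2 * n) W) ∧
      complexBetti.map (ε s).hom (2 * n) (complexBetti.map (fiberι f s) (2 * n) W) ∈ weilClassesOf (Y s) (Ψ s) n d := by
    intro s
    obtain ⟨x, hx, hxH, hxW⟩ := hval s
    rw [hσW] at hx
    have hx' : complexBetti.map (fiberι f s) (2 * n) W = x := (FiberClass.mk_eq_mk_iff _ _).1 hx
    rw [hx']
    exact ⟨hxH, hxW⟩
  -- `W` reads `c` at `s₀` through `e'`
  have hW₀' : complexBetti.map (fiberι f s₀) (2 * n) W = complexBetti.map e'.inv (2 * n) c := by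
    rw [hσW] at hσ₀
    exact (FiberClass.mk_eq_mk_iff _ _).1 hσ₀
  have hread : complexBetti.map e'.hom (2 * n) (complexBetti.map (fiberι f s₀) (2 * n) W) = c := by
    rw [hW₀', e'.complexBetti_map_hom_map_inv]
  -- `W` is fibrewise rational (flat transport of the rational class `e'⁻¹* c`)
  have hWQ : ∀ s, IsRationalClass (complexBetti.map (fiberι f s) (2 * n) W) := by
    intro s
    have hQ₀ : IsRationalClass (complexBetti.map (fiberι f s₀) (2 * n) W) := by
      rw [hW₀']
      exact (isRationalClass_map_iff_of_iso e'.symm).2 hcQ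
    obtain ⟨γ⟩ : Nonempty (Path.Homotopic.Quotient (⟨s₀, Set.mem_univ s₀⟩ : (Set.univ : Set (ComplexPoints S))) ⟨s, Set.mem_univ s⟩) :=
      ⟨⟦(PathConnectedSpace.somePath s₀ s).map (continuous_id.subtype_mk _)⟧⟩
    have htr : transportFun f (2 * n) hUc γ (complexBetti.map (fiberι f s₀) (2 * n) W) = complexBetti.map (fiberι f s) (2 * n) W :=
      transportFun_map_fiberι f (2 * n) hUc γ W
    rw [← htr]
    exact isRationalClass_transportFun_of_isSmoothProjectiveFamily f (2 * n) dS hfam hSqp γ hQ₀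
  -- every fibre is `δ`-charted
  have hch : HasWeilChartsOfDisc n d δ f W := by
    intro s
    obtain ⟨e'', a'', ha'', ha''0, hN''⟩ := hRfib s
    have hΨ : Ψ s ≫ Ψ s = -(d • 𝟙 (Y s)) := by
      rw [← natCast_zsmul]
      exact (hYΨ s).2
    exact ⟨Y s, Ψ s, ε s, (hYΨ s).1, hΨ, (hWval s).2, e'', a'', ha'', ha''0, hN''⟩
  exact ⟨𝒳, S, f, s₀, s₁, e', W, hfam, h𝒳, hSqp, hirr, hsm, fun s => ⟨hWQ s, (hWval s).1⟩, hch, hread,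
    Y s₁, ⟨ε s₁⟩, (hYΨ s₁).1, E₀, χ₀, B, hE, hχ, ⟨u, hu⟩, hcm, hgen⟩

/-- **N73 for EVERY cell `(n, d, δ)`, `n, d ≥ 1`, modulo J1 BY NAME** (L = the tree theorem `deligne1968_invariantClass_fromTotalSpace_holds`).
[cite: Deligne1982HodgeCycles, §4, proof of Thm. 4.8] [cite: vanGeemen1994HodgeAV, 5.3–5.5 and 5.8–5.11] [cite: Deligne1968, Prop. (2.1) with (2.6.3)] -/
theorem isogenyConnectedToCMAnchor_of_J1 (hJ : deligne1982_weilFamily_periodConstructionAtWeilType)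
    (hn : 1 ≤ n) (hd : 1 ≤ d) (δ : weilNormResidueGroup d) : IsogenyConnectedToCMAnchor n d δ :=
  isogenyConnectedToCMAnchor_of_cellSystemReachAt hn hd (cellSystemReachAt_of_J1 hJ hn hd δ)
    deligne1968_invariantClass_fromTotalSpace_holds

/-! ## §4 The route item modulo J1, and the route's exact reach modulo J1 -/
/-- **K3 ⟸ J1 BY NAME.** Item stmt-HodgeConjecture-19825 `SplitImpliesAll.NonsplitCellsConnected` follows from Deligne's period
construction at Weil type ALONE (the binders `δ ≠ [(-1)³]`, `sign δ = (-1)³` are unused: N73 holds on every cell modulo J1). SUPPORT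
theorem — J1 is an unproved named fact, the item stays open. [cite: Deligne1982HodgeCycles, §4, proof of Thm. 4.8]
[cite: vanGeemen1994HodgeAV, Lemma 5.2, 5.3–5.5, (5.4.1)] [cite: Landherr1936HermitianForms, Satz] -/
theorem nonsplitCellsConnected_of_J1 (hJ : deligne1982_weilFamily_periodConstructionAtWeilType) :
    Summit.HodgeConjecture.HodgeConjecture.Theses.SplitImpliesAll.NonsplitCellsConnected :=
  fun d hd δ _ _ => isogenyConnectedToCMAnchor_of_J1 hJ (by norm_num) hd δ

/-- **EXACT REACH OF THE ROUTE MODULO J1**: the leaf `WeilSixfolds` (stmt-HodgeConjecture-2524) from J1, the residual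
`SplitSixfoldCells` and the attacked conjunct `NonsplitSixfoldCells`, through the route's deciding theorem `SplitImpliesAll.closes`;
all three are hypotheses, nothing is asserted. [cite: vanGeemen1994HodgeAV, Lemma 5.2] [cite: Deligne1982HodgeCycles, §4] -/
theorem weilSixfolds_of_J1_of_split_of_nonsplitVariational
    (hJ : deligne1982_weilFamily_periodConstructionAtWeilType)
    (hS : Summit.HodgeConjecture.HodgeConjecture.Theses.SplitImpliesAll.SplitSixfoldCells)
    (hV : Summit.HodgeConjecture.HodgeConjecture.Theses.SplitImpliesAll.NonsplitSixfoldCells) :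
    Summit.HodgeConjecture.HodgeConjecture.Theses.SevenfoldWeilCensus.WeilSixfolds :=
  Summit.HodgeConjecture.HodgeConjecture.Theses.SplitImpliesAll.closes hS hV (nonsplitCellsConnected_of_J1 hJ)

end Summit.HodgeConjecture.HodgeConjecture.Theorems.SplitImpliesAllNonsplitCellsConnectedOfJ1
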